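import Summits.Ventures.HodgeRepro2.T6Interface
import Summits.Ventures.HodgeRepro2.T6ExteriorDualityGraded

/-!
# T6InterfaceParity — bidegree bookkeeping on `H^*(B × B)` for ANY interface datum

Support for the owners' glue into `TransferShadow` (t6-p2 l. 4425: the field `pont_spec` quantifies
over ALL `u : HB K`, while the geometric construction only speaks about even degrees). Everything here
is generic: it is stated for arbitrary `intB`, `intBB`, `cop` satisfying the FIELD-SHAPED hypotheses
`intB_deg`, `intBB_tmul`, `cop_ι` of `TransferShadow`, so an owner instantiates it with the fields of the
datum being built (or with `D.intB_deg`, `D.intBB_tmul`, `D.cop_ι` of a finished `D`).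

* `bideg K s t` / `bisum K j` — the bihomogeneous part of bidegree `(s, t)` of `HBB K` and the sum of
  the bidegrees of total degree `j`; they multiply additively.
* `cop_mem` — an algebra map with `cop (ι v) = ι v ⊗ 1 + 1 ⊗ ι v` sends `H^j(B)` into total degree `j`.
* `intBB_inl_mul_inr_mul_cop_eq_zero` — `∫_{B×B} (a ⊗ b) ∪ m^* u = 0` unless `deg a + deg b + deg u = 48`.
* `intB_mul_eq_zero_of_deg` — `∫_B p ∪ u = 0` unless `deg p + deg u = 24`.
* `eq_of_forall_homogeneous` — two functionals agreeing on every homogeneous component agree.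
* `pont_spec_of_even` — for even `a`, `b` and an even `p`, the identity
  `∫_B p ∪ u = ∫_{B×B} (a ⊗ b) ∪ m^* u` for all `u` follows from its even-`u` instances: on odd `u`
  both sides vanish by degree.

§8(d): uses an L-value-free non-vanishing device: NO.
-/

namespace Summit.Ventures.HodgeRepro2.T6.Parity

open ExteriorAlgebra ExteriorDuality GradedTensorProduct
open scoped TensorProduct

variable (K : Type*) [Field K] [NumberField K]

variable {K}

/-- `pr_1^* a = a ᵍ⊗ₜ 1`. -/
lemma inl_apply (a : HB K) : inl K a = a ᵍ⊗ₜ 1 := rfl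

/-- `pr_2^* b = 1 ᵍ⊗ₜ b`. -/
lemma inr_apply (b : HB K) : inr K b = 1 ᵍ⊗ₜ b := rfl

/-- `pr_1^* a ∪ pr_2^* b = a ᵍ⊗ₜ b` (no Koszul sign against `1`). -/
lemma inl_mul_inr (a b : HB K) : inl K a * inr K b = a ᵍ⊗ₜ b := by
  rw [inl_apply, inr_apply]
  exact tmul_one_mul_one_tmul (fun i : ℕ => ⋀[ℚ]^i (H1 K)) (fun i : ℕ => ⋀[ℚ]^i (H1 K)) a b

/-- `ι v` has degree one. -/
lemma ι_mem_one (v : H1 K) : ι ℚ v ∈ degB K 1 := ι_mem_exteriorPower_one v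

/-- `1` has degree zero. -/
lemma one_mem_zero : (1 : HB K) ∈ degB K 0 := one_mem_exteriorPower_zero

variable (K) in
/-- `a ᵍ⊗ₜ b` as a bilinear map. -/
noncomputable def tmulL : HB K →ₗ[ℚ] HB K →ₗ[ℚ] HBB K :=
  (TensorProduct.mk ℚ (HB K) (HB K)).compr₂
    (of ℚ (fun i : ℕ => ⋀[ℚ]^i (H1 K)) (fun i : ℕ => ⋀[ℚ]^i (H1 K))).toLinearMap

/-- `tmulL a b = a ᵍ⊗ₜ b`. -/
lemma tmulL_apply (a b : HB K) : tmulL K a b = a ᵍ⊗ₜ b := rfl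

variable (K) in
/-- The bihomogeneous part of bidegree `(s, t)` of `H^*(B × B)`. -/
noncomputable def bideg (s t : ℕ) : Submodule ℚ (HBB K) :=
  Submodule.map₂ (tmulL K) (degB K s) (degB K t)

/-- `a ᵍ⊗ₜ b` has bidegree `(deg a, deg b)`. -/
lemma tmul_mem_bideg {s t : ℕ} {a b : HB K} (ha : a ∈ degB K s) (hb : b ∈ degB K t) :
    (a ᵍ⊗ₜ b : HBB K) ∈ bideg K s t :=
  Submodule.apply_mem_map₂ (tmulL K) ha hb

/-- `pr_1^* a` has bidegree `(deg a, 0)`. -/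
lemma inl_mem_bideg {s : ℕ} {a : HB K} (ha : a ∈ degB K s) : inl K a ∈ bideg K s 0 := by
  rw [inl_apply]; exact tmul_mem_bideg ha one_mem_zero

/-- `pr_2^* b` has bidegree `(0, deg b)`. -/
lemma inr_mem_bideg {t : ℕ} {b : HB K} (hb : b ∈ degB K t) : inr K b ∈ bideg K 0 t := by
  rw [inr_apply]; exact tmul_mem_bideg one_mem_zero hb

/-- Bidegrees add under multiplication (Koszul sign absorbed by `zsmul_mem`). -/
lemma bideg_mul_bideg {s t s' t' : ℕ} {x y : HBB K} (hx : x ∈ bideg K s t)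
    (hy : y ∈ bideg K s' t') : x * y ∈ bideg K (s + s') (t + t') := by
  have key : ∀ a ∈ degB K s, ∀ b ∈ degB K t, ∀ a' ∈ degB K s', ∀ b' ∈ degB K t',
      (a ᵍ⊗ₜ b : HBB K) * (a' ᵍ⊗ₜ b') ∈ bideg K (s + s') (t + t') := by
    intro a ha b hb a' ha' b' hb'
    have h : (a ᵍ⊗ₜ b : HBB K) * (a' ᵍ⊗ₜ b') =
        (-1 : ℤˣ) ^ (t * s') • ((a * a') ᵍ⊗ₜ (b * b') : HBB K) :=
      tmul_coe_mul_coe_tmul (fun i : ℕ => ⋀[ℚ]^i (H1 K)) (fun i : ℕ => ⋀[ℚ]^i (H1 K))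
        a ⟨b, hb⟩ ⟨a', ha'⟩ b'
    rw [h, Units.smul_def]
    exact zsmul_mem (tmul_mem_bideg (mul_mem_exteriorPower ha ha')
      (mul_mem_exteriorPower hb hb')) _
  have step1 : ∀ a ∈ degB K s, ∀ b ∈ degB K t,
      (a ᵍ⊗ₜ b : HBB K) * y ∈ bideg K (s + s') (t + t') := by
    intro a ha b hb
    have : bideg K s' t' ≤ Submodule.comap (LinearMap.mulLeft ℚ (a ᵍ⊗ₜ b : HBB K))
        (bideg K (s + s') (t + t')) :=
      Submodule.map₂_le.mpr fun a' ha' b' hb' => Submodule.mem_comap.mpr (key a ha b hb a' ha' b' hb')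
    exact this hy
  have : bideg K s t ≤ Submodule.comap (LinearMap.mulRight ℚ y) (bideg K (s + s') (t + t')) :=
    Submodule.map₂_le.mpr fun a ha b hb => Submodule.mem_comap.mpr (step1 a ha b hb)
  exact this hx

variable (K) in
/-- The sum of the bidegrees of total degree `j`. -/
noncomputable def bisum (j : ℕ) : Submodule ℚ (HBB K) :=
  ⨆ s : {s : ℕ // s ≤ j}, bideg K s (j - s)

/-- Each bidegree `(s, j - s)` lies in the total-degree-`j` part. -/
lemma bideg_le_bisum {s j : ℕ} (hs : s ≤ j) : bideg K s (j - s) ≤ bisum K j :=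
  le_iSup (fun s : {s : ℕ // s ≤ j} => bideg K s (j - s)) ⟨s, hs⟩

/-- Total degrees add under multiplication. -/
lemma bisum_mul_bisum {j j' : ℕ} {x y : HBB K} (hx : x ∈ bisum K j) (hy : y ∈ bisum K j') :
    x * y ∈ bisum K (j + j') := by
  refine Submodule.iSup_induction _ (motive := fun x => x * y ∈ bisum K (j + j')) hx ?_ ?_ ?_
  · rintro ⟨s, hs⟩ x hx
    dsimp only at hx
    refine Submodule.iSup_induction _ (motive := fun y => x * y ∈ bisum K (j + j')) hy ?_ ?_ ?_
    · rintro ⟨s', hs'⟩ y hy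
      dsimp only at hy
      have := bideg_mul_bideg hx hy
      have heq : (j - s) + (j' - s') = (j + j') - (s + s') := by omega
      rw [heq] at this
      exact bideg_le_bisum (by omega) this
    · simp
    · intro y₁ y₂ h₁ h₂
      rw [mul_add]
      exact Submodule.add_mem _ h₁ h₂
  · simp
  · intro x₁ x₂ h₁ h₂
    rw [add_mul]
    exact Submodule.add_mem _ h₁ h₂

/-- `1 = 1 ᵍ⊗ₜ 1` in `H^*(B × B)`. -/
lemma one_eq_tmul : (1 : HBB K) = ((1 : HB K) ᵍ⊗ₜ (1 : HB K) : HBB K) := rfl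

/-- `ι v ⊗ 1 + 1 ⊗ ι v` has total degree one. -/
lemma inl_ι_add_inr_ι_mem (v : H1 K) : inl K (ι ℚ v) + inr K (ι ℚ v) ∈ bisum K 1 := by
  refine Submodule.add_mem _ ?_ ?_
  · exact bideg_le_bisum (le_refl 1) (inl_mem_bideg (ι_mem_one v))
  · exact bideg_le_bisum (Nat.zero_le 1) (inr_mem_bideg (ι_mem_one v))

section cop

variable (cop : HB K →ₐ[ℚ] HBB K)
  (hcop : ∀ v : H1 K, cop (ι ℚ v) = inl K (ι ℚ v) + inr K (ι ℚ v))
include hcop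

/-- An algebra map with `cop (ι v) = ι v ⊗ 1 + 1 ⊗ ι v` sends `H^j(B)` into total degree `j`. -/
lemma cop_mem {j : ℕ} {u : HB K} (hu : u ∈ degB K j) : cop u ∈ bisum K j := by
  induction j generalizing u with
  | zero =>
    rw [degB, exteriorPower, pow_zero, Submodule.mem_one] at hu
    obtain ⟨r, rfl⟩ := hu
    rw [AlgHom.commutes, Algebra.algebraMap_eq_smul_one, one_eq_tmul]
    exact Submodule.smul_mem _ _ (bideg_le_bisum le_rfl (tmul_mem_bideg one_mem_zero one_mem_zero))
  | succ j ih =>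
    rw [degB, exteriorPower, pow_succ] at hu
    refine Submodule.mul_induction_on hu ?_ ?_
    · intro m hm n hn
      obtain ⟨v, rfl⟩ := LinearMap.mem_range.mp hn
      rw [map_mul, hcop]
      exact bisum_mul_bisum (ih hm) (inl_ι_add_inr_ι_mem v)
    · intro x y hx hy
      rw [map_add]
      exact Submodule.add_mem _ hx hy

end cop

section integrals

variable (intB : HB K →ₗ[ℚ] ℚ) (hdeg : ∀ k ≠ 24, ∀ a ∈ degB K k, intB a = 0)
include hdeg

/-- `∫_B p ∪ u = 0` unless `deg p + deg u = 24`. -/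
lemma intB_mul_eq_zero_of_deg {m j : ℕ} {p u : HB K} (hp : p ∈ degB K m) (hu : u ∈ degB K j)
    (h : m + j ≠ 24) : intB (p * u) = 0 :=
  hdeg _ h _ (mul_mem_exteriorPower hp hu)

variable (intBB : HBB K →ₗ[ℚ] ℚ)
  (htmul : ∀ a b : HB K, intBB (inl K a * inr K b) = intB a * intB b)
include htmul

/-- `∫_{B×B} (a ⊗ b) ∪ x = 0` for `x` of bidegree `(s, t)` unless `(deg a + s, deg b + t) = (24, 24)`. -/
lemma intBB_inl_mul_inr_mul_eq_zero {k l s t : ℕ} {a b : HB K}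
    (ha : a ∈ degB K k) (hb : b ∈ degB K l) (hne : ¬ (k + s = 24 ∧ l + t = 24)) {x : HBB K}
    (hx : x ∈ bideg K s t) : intBB (inl K a * inr K b * x) = 0 := by
  have : bideg K s t ≤ LinearMap.ker (intBB ∘ₗ LinearMap.mulLeft ℚ (inl K a * inr K b)) := by
    refine Submodule.map₂_le.mpr fun a' ha' b' hb' => ?_
    rw [LinearMap.mem_ker, LinearMap.comp_apply, LinearMap.mulLeft_apply, tmulL_apply, inl_mul_inr]
    have h : (a ᵍ⊗ₜ b : HBB K) * (a' ᵍ⊗ₜ b') =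
        (-1 : ℤˣ) ^ (l * s) • ((a * a') ᵍ⊗ₜ (b * b') : HBB K) :=
      tmul_coe_mul_coe_tmul (fun i : ℕ => ⋀[ℚ]^i (H1 K)) (fun i : ℕ => ⋀[ℚ]^i (H1 K))
        a ⟨b, hb⟩ ⟨a', ha'⟩ b'
    rw [h, Units.smul_def, map_zsmul, ← inl_mul_inr, htmul]
    rcases not_and_or.mp hne with h1 | h1
    · rw [hdeg _ (by omega) _ (mul_mem_exteriorPower ha ha'), zero_mul, smul_zero]
    · rw [hdeg _ (by omega) _ (mul_mem_exteriorPower hb hb'), mul_zero, smul_zero]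
  exact this hx

/-- `∫_{B×B} (a ⊗ b) ∪ x = 0` for `x` of total degree `j` unless `j + deg a + deg b = 48`
(with both degrees `≤ 24`). -/
lemma intBB_inl_mul_inr_mul_eq_zero_of_bisum {k l j : ℕ} {a b : HB K}
    (ha : a ∈ degB K k) (hb : b ∈ degB K l) (hj : ¬ (k ≤ 24 ∧ l ≤ 24 ∧ j + k + l = 48))
    {x : HBB K} (hx : x ∈ bisum K j) : intBB (inl K a * inr K b * x) = 0 := by
  refine Submodule.iSup_induction _ (motive := fun x => intBB (inl K a * inr K b * x) = 0)
    hx ?_ ?_ ?_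
  · rintro ⟨s, hs⟩ x hx
    dsimp only at hx
    exact intBB_inl_mul_inr_mul_eq_zero intB hdeg intBB htmul ha hb (by omega) hx
  · simp
  · intro x y hx hy
    rw [mul_add, map_add, hx, hy, add_zero]

/-- `∫_{B×B} (a ⊗ b) ∪ m^* u = 0` unless `deg u + deg a + deg b = 48` (with both degrees `≤ 24`). -/
lemma intBB_inl_mul_inr_mul_cop_eq_zero (cop : HB K →ₐ[ℚ] HBB K)
    (hcop : ∀ v : H1 K, cop (ι ℚ v) = inl K (ι ℚ v) + inr K (ι ℚ v)) {k l j : ℕ} {a b u : HB K}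
    (ha : a ∈ degB K k) (hb : b ∈ degB K l) (hu : u ∈ degB K j)
    (hj : ¬ (k ≤ 24 ∧ l ≤ 24 ∧ j + k + l = 48)) : intBB (inl K a * inr K b * cop u) = 0 :=
  intBB_inl_mul_inr_mul_eq_zero_of_bisum intB hdeg intBB htmul ha hb hj (cop_mem cop hcop hu)

end integrals

/-- Two functionals on `H^*(B)` agreeing on every homogeneous component agree. -/
lemma eq_of_forall_homogeneous {f g : HB K →ₗ[ℚ] ℚ}
    (h : ∀ (j : ℕ) (u : HB K), u ∈ degB K j → f u = g u) : f = g := by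
  rw [← sub_eq_zero]
  exact eq_zero_of_forall_comp fun j u hu => by
    rw [LinearMap.sub_apply, h j u hu, sub_self]

/-- `pont_spec` for even classes from its even-`u` instances: for `a ∈ H^{2k}`, `b ∈ H^{2l}`,
`p ∈ H^{2m}` and any `intB`, `intBB`, `cop` with the field-shaped properties, the identity
`∫_B p ∪ u = ∫_{B×B} (a ⊗ b) ∪ m^* u` holds for every `u` as soon as it holds for every
homogeneous `u` of even degree — on odd `u` both sides vanish by degree. -/
theorem pont_spec_of_even (intB : HB K →ₗ[ℚ] ℚ) (hdeg : ∀ k ≠ 24, ∀ a ∈ degB K k, intB a = 0)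
    (intBB : HBB K →ₗ[ℚ] ℚ) (htmul : ∀ a b : HB K, intBB (inl K a * inr K b) = intB a * intB b)
    (cop : HB K →ₐ[ℚ] HBB K) (hcop : ∀ v : H1 K, cop (ι ℚ v) = inl K (ι ℚ v) + inr K (ι ℚ v))
    {k l m : ℕ} {a b p : HB K} (ha : a ∈ degB K (2 * k)) (hb : b ∈ degB K (2 * l))
    (hp : p ∈ degB K (2 * m))
    (heven : ∀ (j : ℕ) (u : HB K), u ∈ degB K (2 * j) → intB (p * u) = intBB (inl K a * inr K b * cop u)) :
    ∀ u : HB K, intB (p * u) = intBB (inl K a * inr K b * cop u) := by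
  have hfun : intB ∘ₗ LinearMap.mulLeft ℚ p =
      intBB ∘ₗ LinearMap.mulLeft ℚ (inl K a * inr K b) ∘ₗ cop.toLinearMap := by
    refine eq_of_forall_homogeneous fun j u hu => ?_
    simp only [LinearMap.comp_apply, LinearMap.mulLeft_apply, AlgHom.toLinearMap_apply]
    rcases Nat.even_or_odd j with ⟨j', hj'⟩ | ⟨j', hj'⟩
    · exact heven j' u (by rw [hj'] at hu; convert hu using 2; ring)
    · rw [intB_mul_eq_zero_of_deg intB hdeg hp hu (by omega),
        intBB_inl_mul_inr_mul_cop_eq_zero intB hdeg intBB htmul cop hcop ha hb hu (by omega)]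
  intro u
  have := LinearMap.congr_fun hfun u
  simpa only [LinearMap.comp_apply, LinearMap.mulLeft_apply, AlgHom.toLinearMap_apply] using this

end Summit.Ventures.HodgeRepro2.T6.Parity
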